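import Literature.NumberTheory.EllipticCurves.PAdicLFunctionMultiplicativeInterpolation
import Literature.NumberTheory.EllipticCurves.HeegnerPoints
import HarnessLib

/-!
# Disegni 2020, §2.2, the `p`-adic Gross–Zagier formula over `ℚ` at a NON-SPLIT multiplicative prime
# (after Disegni, Compositio 2017, Thm. B) — ONE named fact, in the normalisation-free shape of the
# tree's `perrinRiou_padicGrossZagier`

Topic `Literature/NumberTheory/EllipticCurves` (cluster `Disegni2020`, namespace = path). ONE named fact
(`def … : Prop`, cited, nothing asserted; net literature debt +1), no definition besides it, no theorem. HONEST FRAMING (cell `bsd-eis`, run/shared/lean/pub/bsd-eis/, width seat bsd-line-x2-p1-w3 g11 on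
crux 3 `MazurMCOnCellB` = stmt-BirchSwinnertonDyer-19033, line `twistback` v5): this file vendors ONE
published theorem so that the sub-row «`p = 3` non-split, local balance `1`» of that crux no longer needs
the UNREFEREED `p`-converse of Keller–Yin (arXiv:2402.12781, Thm. E): at a non-split multiplicative prime the
passage «`ord_{T=0} L_p(E, T) = 1` ⟹ `ord_{s=1} L(E, s) = 1`» is Perrin-Riou's 1987 argument (Invent. Math.
89, §1.4, good ordinary `p`; in the tree: `BSDSelmerPConverseRankOneRubinProofs`,
`analyticRank_eq_one_of_order_padicLFunction_eq_one`) run with the `p`-adic Gross–Zagier formula that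
holds at such a prime — Disegni's. Nothing about any curve is proved here; no main conjecture / BSD.

## The source, as printed (read 2026-08-28 on the held text `paper:arxiv-1609.02528` = arXiv v3, the
accepted version of D. Disegni, *On the `p`-adic Birch and Swinnerton-Dyer conjecture for elliptic curves
over number fields*, Kyoto J. Math. 60 (2020), no. 2, 473–510 [`Disegni2020`]; page/line locators of that
copy in brackets)

* §1.1.1, Hypothesis (`L_p`) [p. 3]: for `A/K` and a `ℤ_p`-free quotient `Γ` of the Galois group of the
  maximal abelian extension of `K`, an element `L_p^{(Γ)}(A) ∈ 𝒪_L⟦Γ⟧ ⊗ L` with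
  `L_p^{(Γ)}(A)(χ) = ∏_{𝔭∣p} e_𝔭(χ_𝔭) · L(A, χ, 1)/(|D_K|^{-1/2} Ω_A)` at finite-order `χ`, where for
  `χ_𝔭` unramified `e_𝔭(χ_𝔭) = (1 − α_𝔭 χ(𝔭))(1 − α'_𝔭 χ(𝔭)⁻¹)`, `α_𝔭 = −1`, `α'_𝔭 = 0` at a prime of
  NON-split multiplicative reduction (so `e_𝔭(𝟙) = 2`), and `α_𝔭^{-𝔣} τ(χ_𝔭)` if ramified; "Note that
  the interpolation property determines `L_p^{(Γ)}(A)` uniquely if it exists." §1.1.1 [p. 4]: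
  `d^{r̃} L_p(A, 𝟙) ∈ Sym^{r̃} Γ ⊗ L` is the image of `L_p(A)` in `𝓘^{r̃}/𝓘^{r̃+1}`, "the analogue of the
  usual Taylor coefficient". §1.1.3 [p. 4] and §2.1: the canonical height pairing
  `h_ℓ : A(K) × A(K) → Γ ⊗ L` of Nekovář; §1.2.1 [p. 6]: `Γ_K = Γ⁺ × Γ⁻` "with `Γ⁺` identified with `Γ_ℚ`
  via the adèlic norm", `d^±`, `ℓ^± : Γ → Γ^±` the projections, `h^± = h_{ℓ^±}`.
* §2.2.2, the setup [p. 9]: "Let `E/ℚ` be an elliptic curve of conductor `N` with ordinary reduction at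
  the prime `p`. Let `K` be an imaginary quadratic field of discriminant `D` prime to `N` … We factor
  `N = N⁺N⁻` where `N⁺` (respectively, `N⁻`) is a product of primes which are split (respectively,
  inert) in `K`, and we assume that `N⁻` is squarefree. We let `ε := −η(N)`", `X = X^{N⁻}(R)`;
  **Theorem (Gross–Zagier formula)**: "Suppose that `ε = −1` … Let `J` be the Albanese variety of the
  Shimura curve `X` … Let `f : J → E` be a nontrivial morphism, and let `δ(f) = deg(f)` … Let `H` be the
  Hilbert class field of `K` and let `P ∈ X(H)` be a CM point for `K` of conductor `1`. Consider the
  Heegner point `P(f) = u⁻¹ · ∑_{t ∈ Pic(𝒪_K)} f(P)^{σ_t} ∈ E(K)` … Then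
  `L'(A,1)/(|D_K|^{-1/2} Ω_A) = c_∞(A)⁻¹ · h_NT(P(f), P(f))/δ(f)`", `c_∞(A) ∈ ℚ^×`;
  **Proposition** [p. 9]: for `E/ℚ` of conductor `N`, `K = ℚ` or imaginary quadratic of discriminant
  prime to `Np`, `A := E_K`: "`(A, Γ)` satisfies Hypothesis (`L_p`)" ("a theorem of Amice–Vélu and
  Vishik (see [MTT]) for `E`, and of Perrin-Riou [PRL] for `E_K` (for `p` odd, in general see [dd])");
  **Theorem (`p`-adic Gross–Zagier formula)** [p. 9; Thm. 2.4 in the numbering used by the tree's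
  `Disegni2020/PAdicBSDRankOneNonsplit.lean`]: "Under the assumptions of Theorem (Gross–Zagier
  formula), suppose moreover that `p` splits in `K`, and that `E` has ordinary (good or multiplicative)
  reduction at `p`. Then `d⁺L_p(A, 𝟙) = ∏_{𝔭∣p} e_𝔭(𝟙) · c_∞(A)⁻¹ · h⁺(P(f), P(f))/δ(f)` in `Γ⁺ ⊗ L`.
  Note that when `E` has split multiplicative reduction, the identity is the trivial `0 = 0`. *Proof.*
  This is a special case of the analogous result to [CST], which can be obtained by applying word for
  word the arguments of op. cit. to [dd] instead of [YZZ]. When `E` has good reduction and all `v ∣ N`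
  split in `K`, this formula was proved by Perrin-Riou [PR]." ([dd] = Disegni, *The `p`-adic
  Gross–Zagier formula on Shimura curves*, Compos. Math. 153 (2017), Thm. B — "for all `v ∣ p`, `A/F_v`
  has potentially `𝔭`-ordinary good or semistable reduction, `E_v/F_v` is split, and `χ` is not
  exceptional"; at `χ = 𝟙` a multiplicative prime is exceptional iff SPLIT; [CST] = Cai–Shu–Tian,
  Algebra Number Theory 8 (2014).)
* §3.1 [p. 11], Lemma (split/inert) and Proposition (invariance) (2): for `E/ℚ` multiplicative at `p`
  and `K` imaginary quadratic with `p` unramified, "`p` splits in `K`" iff "`E` and `E^{(K)}` have the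
  same reduction type at `p`"; with `Γ = Γ_ℚ` "(which we also view as a quotient of `Γ_K`) … Hypothesis
  (`L_p`) holds for `E`, the twist `E^{(K)}`, and the base-change `E_K`", and (BSD_p) for `(E, Γ_ℚ)`
  and `(E^{(K)}, Γ_ℚ)` transfers to `(E_K, Γ_ℚ)` and back ("classical … adapt"): the restriction of
  `L_p(E_K)` to the cyclotomic line `Γ⁺ = Γ_ℚ` is, by the uniqueness in (`L_p`) and Artin formalism
  `L(E_K, χ∘N, s) = L(E, χ, s)·L(E^{(K)}, χ, s)`, a NON-ZERO constant multiple (periods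
  `|D_K|^{-1/2} Ω_{E_K}` versus `Ω_E Ω_{E^{(K)}}`) of `L_p(E) · L_p(E^{(K)})` — the analogue of
  Perrin-Riou's (1.1), by which the tree's `perrinRiou_padicGrossZagier` is transcribed
  (`PAdicGrossZagier.lean`: `padicLFunctionEK := L_p(f,α,T)·L_p(g,α,T)`). §3.2.1 [p. 12] USES the
  theorem exactly this way for the non-split case of Thm. 1.1 ("This argument was of course already made
  by Perrin-Riou [PR] when `E` has good reduction").

## The transcription (implied by, never stronger than, the source)

Frame: `W/ℚ` globally minimal elliptic (the curve `E`; `f : J₀(N) → E` the parametrisation inside the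
tree's `IsHeegnerPoint`, `N⁻ = 1`, `X = X₀(N)`), `p ≠ 2` a prime of NON-split multiplicative reduction
(so `e_𝔭(𝟙) e_𝔭̄(𝟙) = 4 ≠ 0`; `p ≠ 2` because the tree's cyclotomic variable `T ↔ γ = 1 + p` and its
multiplicative interpolation package are the odd-prime ones — the source allows every `p`), `K`
imaginary quadratic with `d_K` prime to `N = N_E`, EVERY prime of `N` split in `K`
(`SatisfiesHeegnerHypothesis N K`: `N⁻ = 1`, `ε = −η(N) = −1`, so `L(E_K, 1) = 0` and `d⁺L_p(E_K, 𝟙)` is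
the linear term), `p` split in `K` (stated, as printed; it follows from `p ∣ N`), `f_E` a newform of `W`
and `g` a newform of the twist `E^{(d_K)}` (which is again non-split multiplicative at `p`, Lemma 3.2),
`L` and `M` THE non-split Mazur–Tate–Teitelbaum functions of `f_E` and `g` (`IsMultPAdicLFunctionOf · p (−1) ·`,
unique by boundedness + interpolation), `P ∈ E(K)` a Heegner point of level `N` (`IsHeegnerPoint`; the
source's `P(f)` up to the unit factor `u`). In the variable `T` (`γ ↦ 1 + T`, `𝓘/𝓘² ∋ T ↦ γ ⊗ 1`) the
printed identity reads `[T¹](c · L · M) · (γ ⊗ 1) = 4 · c_∞(E_K)⁻¹ · h⁺(P(f), P(f))/δ(f)` with `c ≠ 0`;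
the sign / `χ ↔ χ̄` conventions of the interpolation change `T` by the automorphism `1 + T ↦ (1 + T)⁻¹`,
which preserves the vanishing of the linear term. RECORDED (the consequence Perrin-Riou's §1.4 argument
consumes; the tree has no canonicity predicate for a `K`-height at a multiplicative prime, so the height
itself is not transcribed): since `h⁺ = h_{ℓ⁺}` is a bilinear pairing on `A(K)`, a TORSION Heegner point
has `h⁺(P(f), P(f)) = 0`, hence `d⁺L_p(E_K, 𝟙) = 0`, i.e. **the `T`-coefficient of `L · M` vanishes**.
Contrapositive, as used: `[T¹](L_p(E,T) · L_p(E^{(K)},T)) ≠ 0 ⟹` the Heegner point has infinite order.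

## What this file provides

* `padicGrossZagier_nonsplitMult` (NAMED FACT, nothing asserted; users take `(h : padicGrossZagier_nonsplitMult)` and
  use the contrapositive «`[T¹](L·M) ≠ 0` ⟹ the Heegner point has infinite order» inline; no API lemma, so that the
  file is statement-only).

References: [Disegni2020] §2.2 (Thm. "p-adic Gross–Zagier formula" = Thm. 2.4, Prop. "(L_p)" = Prop. 2.1),
§3.1 (Lemma 3.2, Prop. 3.3 (2)), §3.2.1; [Disegni2017] Thm. B (§1.3); [PerrinRiou1987] Thm. 1.3, (1.1), §1.4
(the good-reduction case); [CaiShuTian2014] (explicit form); [MazurTateTeitelbaum1986] §I.10, §I.14 (the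
non-split function, `α = −1`, one Euler-type factor); [GreenbergLNM1716] §4 p. 111 (the argument this feeds).
-/

noncomputable section

open scoped Classical MatrixGroups ModularForm

open CongruenceSubgroup WeierstrassCurve NumberField Literature.NumberTheory.EllipticCurves.ModularForms

namespace Literature.NumberTheory.EllipticCurves.Disegni2020

/-! ### The named fact -/

/-- **Disegni 2020, §2.2, Theorem (`p`-adic Gross–Zagier formula) [= Thm. 2.4], at a NON-SPLIT
multiplicative prime — normalisation-free consequence.** (D. Disegni, Kyoto J. Math. 60 (2020): "Under the
assumptions of Theorem (Gross–Zagier formula) [`E/ℚ` of conductor `N` ordinary at `p`; `K` imaginary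
quadratic of discriminant `D` prime to `N`; `N⁻` squarefree with `ε = −η(N) = −1`; `f : J → E` a
nontrivial morphism; `P(f) ∈ E(K)` the Heegner point], suppose moreover that `p` splits in `K`, and that
`E` has ordinary (good or multiplicative) reduction at `p`. Then
`d⁺L_p(A, 𝟙) = ∏_{𝔭∣p} e_𝔭(𝟙) · c_∞(A)⁻¹ · h⁺(P(f), P(f))/δ(f)` in `Γ⁺ ⊗ L`" (`A = E_K`; `e_𝔭(𝟙) = 2` at
a non-split multiplicative prime, Hyp. (`L_p`) §1.1.1; `c_∞(A) ∈ ℚ^×`; `δ(f) = deg f`; `h⁺ = h_{ℓ⁺}` the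
canonical height pairing on `A(K)` in the cyclotomic direction, §1.2.1), proof "word for word [CST]
applied to [dd]" = Disegni, Compos. Math. 153 (2017) Thm. B ("potentially `𝔭`-ordinary good or
semistable reduction … `χ` not exceptional" — at `χ = 𝟙` exceptional iff split); the restriction of
`L_p(E_K)` to `Γ⁺ = Γ_ℚ` is a non-zero constant multiple of `L_p(E)·L_p(E^{(K)})` (§3.1 Prop. (invariance)
(2) with Lemma (split/inert) and the uniqueness in Hyp. (`L_p`); Perrin-Riou 1987 (1.1) in the good case).)
TRANSCRIPTION (module docstring): for `W/ℚ` globally minimal elliptic, `p ≠ 2` of non-split multiplicative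
reduction, `K` imaginary quadratic with `d_K` prime to `N = N_E`, every prime of `N` split in `K` and `p`
split in `K`, `f` a newform of `W`, `g` a newform of `E^{(d_K)}`, `L`, `M` THE non-split
Mazur–Tate–Teitelbaum functions of `f`, `g` (`IsMultPAdicLFunctionOf · p (−1) ·`), and `P ∈ E(K)` a Heegner
point of level `N`: **if `P` is torsion then the `T`-coefficient of `L · M` vanishes** (`h⁺` is bilinear,
so `h⁺(P,P) = 0`, so `d⁺L_p(E_K, 𝟙) = 0`). Implied by, never stronger than, the printed identity; the
height is deliberately not transcribed. Nothing is asserted (named fact, D-0014).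
[cite: Disegni2020, §2.2 Thm. (p-adic Gross–Zagier formula) = Thm. 2.4, with §1.1.1 Hyp. (L_p), §1.2.1, §3.1 Prop. 3.3 (2), §3.2.1]
[cite: Disegni2017, Thm. B (§1.3)] [cite: PerrinRiou1987, Thm. 1.3 and (1.1) (the good ordinary case)]
[cite: MazurTateTeitelbaum1986, §I.10 and §I.14] -/
def padicGrossZagier_nonsplitMult : Prop :=
  ∀ (W : WeierstrassCurve ℚ) [W.IsElliptic] [W.IsGloballyMinimal] (p : ℕ) [Fact p.Prime]
    (K : Type) [Field K] [NumberField K] (N : ℕ) [NeZero N]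
    {Nf Ng : ℕ} [NeZero Nf] [NeZero Ng] {f : CuspForm (Gamma0 Nf) 2} {g : CuspForm (Gamma0 Ng) 2}
    (_hf : IsNewformOf W f) (_hg : IsNewformOf (W.quadraticTwist (NumberField.discr K : ℚ)) g),
    p ≠ 2 → W.HasMultiplicativeReductionAtPrime p → ¬ W.HasSplitMultiplicativeReductionAtPrime p →
    IsImaginaryQuadratic K → IsCoprime (NumberField.discr K) (N : ℤ) → W.conductorNorm ℤ = N →
    SatisfiesHeegnerHypothesis N K → ((Ideal.span {(p : ℤ)}).primesOver (𝓞 K)).ncard = 2 →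
    ∀ (L M : PowerSeries ℚ_[p]), IsMultPAdicLFunctionOf f p (-1) L → IsMultPAdicLFunctionOf g p (-1) M →
    ∀ (P : (W.baseChange K).toAffine.Point), IsHeegnerPoint N W K P →
      IsOfFinAddOrder P → PowerSeries.coeff 1 (L * M) = 0

end Literature.NumberTheory.EllipticCurves.Disegni2020

end
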